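import Summits.QuantumFields.YangMills.Theorems.StaticSourceWitnessAssembly
import Summits.QuantumFields.YangMills.Theorems.UniversalDetectorReflectedKernel
import Summits.QuantumFields.YangMills.Theorems.BalabanLadderUVSeamRecResponseMomentsPinning
import Summits.QuantumFields.YangMills.Theorems.BalabanLadderNTMarkovMirrorDefectTypical
import Literature.MathematicalPhysics.QuantumFieldTheory.SpeciesTimeReflection
import Literature.MathematicalPhysics.QuantumLattice.CentreSymmetryConfinementProofs
import HarnessLib

/-!
# Route `StaticSourceWitness`, LINE g9-2 «ratio peeling» — the glue `RatioPeelingGlue`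

Ideator seat ym-idea-8 (generation 9, lens «dual»: the cube-kernel conditional expectation as an L²-projection,
peeled on BOTH slots of the mirror covariance of ONE loop).  The parent item `FarMirrorLoopCeiling`
(stmt-QuantumFields-25418: projective ratio clustering `E_T[(w∘Θ)w] − E_T[w]² ≤ C₂·E_T[w]²` of a far-mirror femto
loop at the static-source unit) is split into

* `LoopKernelRatioResponse` (crux, engine): the RELATIVE mean-square response of the loop to boundary data one
  loop-size away, `E_T[(E[w|∂Q] − E_T w)²] ≤ C·E_T[w]²` — the mathematical content of the Lüscher–Weisz multilevel
  factorisation, one loop and one cube;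
* `MirrorPeeling` (support, shared with route `FiniteRankMirror`, proved in `Theorems/FiniteRankMirrorMirrorPeeling`);
* `SmallTorusMirrorCeiling` (crux): the bounded-torus regime `a(β)L ≤ Λ` of the parent, where no response cube fits
  inside the window;

and this file proves the glue.  §1 is the spatial translation of a loop and of its mirror product (the periodic
Wilson state is translation invariant and a spatial translation commutes with the link reflection); §2 the glue.

HONEST FRAMING: bookkeeping over two OPEN crux items; nothing of E1, NT or the mass gap is proved here; no summit
is proved by this line; not Clay.
-/

set_option autoImplicit false

noncomputable section

open MeasureTheory Filter Topology
open Literature.MathematicalPhysics.QuantumFieldTheory Literature.MathematicalPhysics.QuantumLattice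
open Literature.Probability.LatticeModels
open Summit.QuantumFields.YangMills.Cruxes.OSLegsFromFemtoAndGap.DlrCollarTransfer
open Summit.QuantumFields.YangMills.Cruxes.UniversalDetectorPlaneTight (torusE_configShift_neg)
open Summit.QuantumFields.YangMills.Cruxes.NT.MarkovMirror (torusE_mono)
open Summit.QuantumFields.YangMills.Cruxes.NT.Reference (continuous_kerE)
open Summit.QuantumFields.YangMills.Cruxes.UVSeamRec.ResponsePinning (torusE_const)
open Summit.QuantumFields.YangMills.Theorems.StaticSourceWitness (dartStep_fst_coord_bounds)

namespace Summit.QuantumFields.YangMills.Cruxes.StaticSourceWitnessRatioPeeling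

variable {G : Type} [Group G] [TopologicalSpace G] [IsTopologicalGroup G] [CompactSpace G]
  [MeasurableSpace G] [BorelSpace G] (r : LatticeRep G)

/-! ## §1 Spatial translation of a loop and of its mirror product -/

omit [TopologicalSpace G] [IsTopologicalGroup G] [CompactSpace G] [BorelSpace G] in
/-- A purely spatial translation (`v 0 = 0`) commutes with the link reflection. [folklore] -/
theorem cfgReflect_configShift_spatial (v : Site 4) (hv : v 0 = 0) (U : LGConfig 4 G) :
    cfgReflect (configShift v U) = configShift v (cfgReflect U) := by
  have hsv : siteReflect v = v := by
    funext k
    by_cases hk : k = 0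
    · subst hk; rw [siteReflect_apply_zero, hv, neg_zero]
    · exact siteReflect_apply_of_ne v hk
  rw [cfgReflect_configShift, hsv]

omit [TopologicalSpace G] [IsTopologicalGroup G] [CompactSpace G] [BorelSpace G] in
/-- The Wilson loop based at `x' + v` is the loop based at `x'` seen through the translation `τ_{-v}`. [folklore] -/
theorem wilsonLoopObs_rectWalk_add (χ : G → ℝ) (x' v : Site 4) (i j : Fin 4) (R T : ℕ) (U : LGConfig 4 G) :
    wilsonLoopObs χ (rectWalk (x' + v) i j R T) U = wilsonLoopObs χ (rectWalk x' i j R T) (configShift (-v) U) := by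
  have hU : configShift v (configShift (-v) U) = U := by
    funext e; simp [Literature.MathematicalPhysics.QuantumLattice.configShift_apply]
  unfold wilsonLoopObs
  rw [← walkHolonomy_configShift_rectWalk v (configShift (-v) U) x' i j R T, hU]

/-- Torus expectations of a loop and of its mirror product are invariant under spatial translation of the base
point. [folklore: translation invariance of the periodic Wilson state] -/
theorem torusE_loop_pair_spatial (β : ℝ) (L : ℕ) (χ : G → ℝ) (x' v : Site 4) (hv : v 0 = 0) (i j : Fin 4)
    (R T : ℕ) :
    torusE G r β L (wilsonLoopObs χ (rectWalk (x' + v) i j R T)) = torusE G r β L (wilsonLoopObs χ (rectWalk x' i j R T)) ∧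
    torusE G r β L (fun V => wilsonLoopObs χ (rectWalk (x' + v) i j R T) (cfgReflect V) *
        wilsonLoopObs χ (rectWalk (x' + v) i j R T) V) =
      torusE G r β L (fun V => wilsonLoopObs χ (rectWalk x' i j R T) (cfgReflect V) *
        wilsonLoopObs χ (rectWalk x' i j R T) V) := by
  have h1 : wilsonLoopObs χ (rectWalk (x' + v) i j R T) =
      fun U => wilsonLoopObs χ (rectWalk x' i j R T) (configShift (-v) U) :=
    funext (wilsonLoopObs_rectWalk_add χ x' v i j R T)
  have hneg : (-v) 0 = 0 := by simp [hv]
  refine ⟨by rw [h1]; exact torusE_configShift_neg r β L (wilsonLoopObs χ (rectWalk x' i j R T)) v, ?_⟩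
  have h2 : (fun V => wilsonLoopObs χ (rectWalk (x' + v) i j R T) (cfgReflect V) *
      wilsonLoopObs χ (rectWalk (x' + v) i j R T) V) =
      fun V => (fun U => wilsonLoopObs χ (rectWalk x' i j R T) (cfgReflect U) * wilsonLoopObs χ (rectWalk x' i j R T) U)
        (configShift (-v) V) := by
    funext V
    simp only [h1, cfgReflect_configShift_spatial (-v) hneg]
  rw [h2]
  exact torusE_configShift_neg r β L
    (fun U => wilsonLoopObs χ (rectWalk x' i j R T) (cfgReflect U) * wilsonLoopObs χ (rectWalk x' i j R T) U) v

/-! ## §2 The glue -/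

/-- **The ratio-peeling glue**: `LoopKernelRatioResponse → MirrorPeeling → SmallTorusMirrorCeiling → FarMirrorLoopCeiling`.
Bounded tori (`a(β)L ≤ 3ℓ₂ + 4`) are the third item; on larger tori the loop is moved to the time axis by a spatial
translation, both slots of the mirror covariance are peeled onto the kernel of the cube `[1, 1+b] × [−m, −m+b]³`
(`m = t+R+T`, `b = 2m+R+T`) with `p₁ = p₂ = E_T[w]`, and the kernel ratio response closes:
`E_T[(w∘Θ)w] − E_T[w]² ≤ 2·E_T[(E[w|∂Q] − E_T w)²] ≤ 2C·E_T[w]²`. [folklore bookkeeping over the two open crux items] -/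
theorem ratioPeelingGlue_proof :
    Summit.QuantumFields.YangMills.Theses.StaticSourceWitness.LoopKernelRatioResponse →
    Summit.QuantumFields.YangMills.Theses.StaticSourceWitness.MirrorPeeling →
    Summit.QuantumFields.YangMills.Theses.StaticSourceWitness.SmallTorusMirrorCeiling →
    Summit.QuantumFields.YangMills.Theses.StaticSourceWitness.FarMirrorLoopCeiling := by
  intro hK hMP hS G _ _ _ _ hG
  letI : MeasurableSpace G := borel G
  haveI : BorelSpace G := ⟨rfl⟩
  intro r a ha ha0 hpin
  obtain ⟨ℓ₂, C, β₆, hℓ₂, hK1⟩ := hK G hG r a ha ha0 hpin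
  obtain ⟨ℓ₃, C₃, β₇, hℓ₃, hS1⟩ := hS G hG r a ha ha0 hpin (3 * ℓ₂ + 4)
  obtain ⟨βa, hβa⟩ : ∃ βa : ℝ, ∀ β, βa ≤ β → a β ≤ 1 :=
    Filter.eventually_atTop.mp (ha0.eventually (eventually_le_nhds one_pos))
  refine ⟨min ℓ₂ ℓ₃, max (2 * C) C₃, max (max β₆ β₇) βa, lt_min hℓ₂ hℓ₃, ?_⟩
  intro β hβ L x i j R T hij hR hT hRT hwin hxL hEw
  simp only [max_le_iff] at hβ
  have hsq0 : 0 ≤ torusE G r β L (wilsonLoopObs (fun g => (r.ρ g).trace.re) (rectWalk x i j R T)) ^ 2 := sq_nonneg _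
  by_cases hΛ : a β * L ≤ 3 * ℓ₂ + 4
  · exact (hS1 β hβ.1.2 L x i j R T hij hR hT hRT (hwin.trans (min_le_right _ _)) hxL hEw hΛ).trans
      (mul_le_mul_of_nonneg_right (le_max_right _ _) hsq0)
  push Not at hΛ
  haveI := r.secondCountableTopology
  -- the base point on the time axis and the spatial offset
  obtain ⟨t, ht⟩ : ∃ t : ℕ, x 0 = t := ⟨(x 0).toNat, (Int.toNat_of_nonneg (by omega)).symm⟩
  let x' : Fin 4 → ℤ := fun k => if k = 0 then (t : ℤ) else 0
  let v : Fin 4 → ℤ := fun k => if k = 0 then 0 else x k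
  have hv : v 0 = 0 := by simp [v]
  have hxv : x = x' + v := by
    funext k
    by_cases hk : k = 0
    · subst hk; simp [x', v, ht]
    · simp [x', v, hk]
  have ha1 : a β ≤ 1 := hβa β hβ.2
  have haβ : 0 < a β := ha β
  have hwin' : ((t : ℝ) + R + T + 1) * a β ≤ ℓ₂ := by
    have : ((x 0 : ℤ) : ℝ) = (t : ℝ) := by rw [ht]; simp
    rw [← this]; exact hwin.trans (min_le_left _ _)
  -- lattice torus condition from the physical one
  have hL : 2 * t + 3 * R + 3 * T + 4 ≤ L := by
    have h1 : ((2 * t + 3 * R + 3 * T + 4 : ℕ) : ℝ) * a β ≤ 3 * ℓ₂ + 1 := by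
      push_cast
      nlinarith
    have h2 : ((2 * t + 3 * R + 3 * T + 4 : ℕ) : ℝ) * a β < (L : ℝ) * a β := by linarith [mul_comm (a β) (L : ℝ)]
    exact_mod_cast (lt_of_mul_lt_mul_right h2 haβ.le).le
  -- reduce to the loop based on the time axis
  set χ : G → ℝ := fun g => (r.ρ g).trace.re with hχdef
  obtain ⟨hE1, hE2⟩ := torusE_loop_pair_spatial r β L χ x' v hv i j R T
  rw [hxv, hE1, hE2]
  set w' : LGConfig 4 G → ℝ := wilsonLoopObs χ (rectWalk x' i j R T) with hw'
  -- loop facts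
  have hχ : Continuous χ := Complex.continuous_re.comp (r.continuous.matrix_trace)
  have hWc : Continuous w' := continuous_wilsonLoopObs hχ _
  obtain ⟨M, hM⟩ := exists_abs_wilsonLoopObs_le (x := x') hχ (rectWalk x' i j R T)
  have hWS := isCylinder_wilsonLoopObs χ (rectWalk x' i j R T)
  -- the response cube
  let c : Fin 4 → ℤ := fun k => if k = 0 then (1 : ℤ) else -((t : ℤ) + R + T)
  let b : ℕ := 2 * (t + R + T) + R + T
  have hc0 : 1 ≤ c 0 := by simp [c]
  have htRT : R + T ≤ t := by omega
  have hc : ∀ k, -(L : ℤ) + 2 ≤ c k ∧ c k + (b : ℤ) + 3 ≤ (L : ℤ) := by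
    intro k
    by_cases hk : k = 0
    · subst hk; simp only [c, b, if_true]; push_cast; constructor <;> omega
    · simp only [c, b, hk, if_false]; push_cast; constructor <;> omega
  have hW : ∀ e ∈ ((rectWalk x' i j R T).darts.map fun e => (dartStep e).1).toFinset,
      ∀ k, c k ≤ e.1 k ∧ e.1 k ≤ c k + b := by
    intro e he k
    rw [List.mem_toFinset, List.mem_map] at he
    obtain ⟨e', he', rfl⟩ := he
    have h := dartStep_fst_coord_bounds x' i j R T he' k
    by_cases hk : k = 0
    · subst hk; simp only [c, b, x', if_true] at h ⊢; push_cast; constructor <;> omega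
    · simp only [c, b, x', hk, if_false] at h ⊢; push_cast; constructor <;> omega
  -- peel both slots onto the cube kernel
  have peel := hMP G r β L c b hc0 hc w' w' M M _ _ hWc hWc hM hM hWS hWS hW hW
    (torusE G r β L w') (torusE G r β L w')
  -- the kernel ratio response
  have hK := hK1 β hβ.1.1 L t i j R T hij hR hT htRT hwin' hL (by rw [← hE1, ← hxv]; exact hEw)
  change torusE G r β L (fun U => (kerE G r β c b U w' - torusE G r β L w') ^ 2) ≤ C * torusE G r β L w' ^ 2 at hK
  set V := torusE G r β L (fun U => (kerE G r β c b U w' - torusE G r β L w') ^ 2) with hV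
  have hV0 : 0 ≤ V := by
    have hkc : Continuous fun U => kerE G r β c b U w' := continuous_kerE (G := G) (r := r) β c b hWc hM
    have h := torusE_mono G r β L (A := fun _ => (0 : ℝ))
      (B := fun U => (kerE G r β c b U w' - torusE G r β L w') ^ 2) continuous_const
      ((hkc.sub continuous_const).pow 2) fun U => sq_nonneg _
    rwa [torusE_const r] at h
  have hss : Real.sqrt V * Real.sqrt V = V := Real.mul_self_sqrt hV0
  have h2 : torusE G r β L (fun V => w' (cfgReflect V) * w' V) - torusE G r β L w' ^ 2 ≤ 2 * V := by
    have := (le_abs_self _).trans peel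
    rw [sq]; nlinarith [hss]
  calc torusE G r β L (fun V => w' (cfgReflect V) * w' V) - torusE G r β L w' ^ 2 ≤ 2 * V := h2
    _ ≤ 2 * C * torusE G r β L w' ^ 2 := by nlinarith [hK, hV0]
    _ ≤ max (2 * C) C₃ * torusE G r β L w' ^ 2 := mul_le_mul_of_nonneg_right (le_max_left _ _) (sq_nonneg _)

end Summit.QuantumFields.YangMills.Cruxes.StaticSourceWitnessRatioPeeling

/-- **The ratio-peeling glue** — item `RatioPeelingGlue` of route `StaticSourceWitness` (LINE g9-2 of ideator seat
ym-idea-8): `LoopKernelRatioResponse → MirrorPeeling → SmallTorusMirrorCeiling → FarMirrorLoopCeiling`. [folklore bookkeeping] -/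
theorem Summit.QuantumFields.YangMills.Theorems.staticSourceWitness_ratioPeelingGlue :
    Summit.QuantumFields.YangMills.Theses.StaticSourceWitness.RatioPeelingGlue :=
  Summit.QuantumFields.YangMills.Cruxes.StaticSourceWitnessRatioPeeling.ratioPeelingGlue_proof

end
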